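import Summits.BirchSwinnertonDyer.Rank1Residual.X9.LeafDischarge
import Summits.BirchSwinnertonDyer.Rank1Residual.X10.LeafDischargeX10b
import Literature.NumberTheory.EllipticCurves.MastellaZerman2026.HasPadicScalarImageOfIrreducibleProofs
import Literature.NumberTheory.EllipticCurves.ModularityVersionApProofs
import Literature.NumberTheory.EllipticCurves.HeegnerHypothesisKroneckerProofs
import HarnessLib

/-!
# Classes X9 / X10b: the DISCHARGE INTERFACE for Mastella–Zerman 2026 Cor. 4.6 (Howard's Thm. B
# WITHOUT surjectivity) — the image certificate "`ρ_{E,p^∞}(Γ_ℚ) ∋ 1 + pℤ_p`" is a THEOREM on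
# both leaves

Print-tier cell `bsd-print-x9` (D-0131 (2), key `x9`), typer seat ty2, file P of the discharge
interface (A = `X9/LeafDischarge`, B = `X10/LeafDischargeX10b`, C = `X9/LeafDischargeHeegner`, …,
O = `X10/LeafDischargeX10bKolyvaginProp44`). Theorems only: no definition, no new named fact
(D-0014 / D-0026); nothing here is a class theorem; X9 and X10b keep their labels.

The cell's ty1 seat typed Mastella–Zerman, *On anticyclotomic Euler and Kolyvagin systems*, Ann.
Math. Québec (2026), Cor. 4.6 (= Howard 2004 Thm. B, one divisibility of Perrin-Riou's Heegner-point
main conjecture) as the named fact `MastellaZerman2026.cor46_howardDivisibility_of_scalarImage`,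
printed under: `E/ℚ` non-CM, `E[p]` irreducible, **the `p`-adic image contains the scalars
`1 + pℤ_p`** (Assumption 2.13 (v), `MastellaZerman2026.HasPadicScalarImage W p`), `p` odd, `K`
imaginary quadratic with `d_K ∉ {-3,-4}`, `(Np, d_K) = 1`, `p ∤ h_K`, Heegner for `N`, good ordinary
at `p`. The referee counted the scalar condition as a per-pair certificate ("0/790 X9 and 0/39 X10b
pairs certified", REF-70). It is in fact a THEOREM on both leaves: by Lombardo–Tronto 2022
(Thm. 3.16 case 3 / Prop. 3.12), proved in the kernel for every `E/ℚ` with `E[p]` irreducible,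
`ρ̄_{E,p}` not surjective and `p` odd
(`MastellaZerman2026.hasPadicScalarImage_of_hasIrreducibleModPGaloisRep_of_not_hasSurjectiveModNGaloisRep`,
file `Literature/…/MastellaZerman2026/HasPadicScalarImageOfIrreducibleProofs.lean`; mechanism:
coset-averaging induction on the level, `GaloisRepresentations/PadicImageScalarsOfPrimeToPResidualImageProofs`).

This file reads it on the leaves:

1. `ClassX9.hasPadicScalarImage` — every X9 pair (`p ∈ {5,7}`, irreducible, non-surjective)
   satisfies MZ26 Assumption 2.13 (v); `ClassX10.hasPadicScalarImage_of_not_surj` — every X10b pair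
   (`p = 3`, images 3Ns/3Nn) does.
2. `ClassX9.not_dvd_conductorNorm` — `p ∤ N_E` (good reduction; MZ26 §2.1 "`N` coprime with `p`").
3. `ClassX9.mz26Hypotheses` — CONSTRUCTOR of `MastellaZerman2026.Hypotheses (N_E) W K p κ γ` at an X9
   pair on a Heegner frame: the class-level fields (elliptic, non-CM, (irr), scalars, `p` odd,
   `p ∤ N_E`, good ordinary) come from the leaf predicate; `p ∤ d_K` from `p` split in `K`
   (`SatisfiesHeegnerHypothesis p K`); what is LEFT per frame is exactly MZ26 Assumption 2.1:
   `K` imaginary quadratic with `d_K ∉ {-3,-4}`, Heegner for `N_E`, `p ∤ h_K`, and the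
   anticyclotomic datum `(κ, γ)`. `ClassX10.mz26Hypotheses_of_not_surj` — the same at `p = 3`
   (X10b has CM members: non-CM is an explicit binder there, as in the Heegner road p547087).
4. `ClassX9.mz26_cor46` / `ClassX10.mz26_cor46_of_not_surj` — Cor. 4.6 BY NAME on the leaves
   (binder `hMZ : cor46_howardDivisibility_of_scalarImage`): Howard's divisibility
   `char(X_tors) ∣ I(ℋ_∞)²` for every `Λ`-adic Selmer / Heegner-family / Selmer-dual datum, the
   missing (sur)-free input of Burungale–Castella–Skinner 2025 Thm. 4.2.1 (their only use of
   [How04, Thm. B]; ty1 PRINT-INPUTS-X9 §18) at irreducible NON-surjective image.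

Binder order as in files A–O: published fact, class hypothesis, then per-frame data.

## References

* [MastellaZerman2026] L. Mastella, F. Zerman, Ann. Math. Québec (2026) = arXiv:2505.08710,
  Assumptions 2.1, 2.13, §4.1, Cor. 4.6.
* [LombardoTronto2022] D. Lombardo, S. Tronto, Pacific J. Math. 320 (2022), Prop. 3.4, Cor. 3.7,
  Prop. 3.12, Thm. 3.16.
* [Howard2004HeegnerKolyvagin] B. Howard, Compositio Math. 140 (2004), Thm. B.
* [BurungaleCastellaSkinner2025] arXiv:2405.00270v2, Thm. 4.2.1 and its proof (p. 8).
-/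

set_option autoImplicit false

noncomputable section

open scoped Classical

open _root_.WeierstrassCurve _root_.Field Literature.NumberTheory.EllipticCurves
  Literature.NumberTheory.EllipticCurves.MastellaZerman2026

universe u

namespace Literature.NumberTheory.EllipticCurves.Rank1Residual

/-! ## 1. Class X9 (`p ∈ {5, 7}`) -/

section X9

variable {W : WeierstrassCurve ℚ} [W.IsGloballyMinimal] {p : ℕ} [Fact p.Prime]

/-- **MZ26 Assumption 2.13 (v) holds on class X9**: the `p`-adic image of `Γ_ℚ` on `T_pE` contains
every scalar `≡ 1 (mod p)` (Lombardo–Tronto 2022 Thm. 3.16 case 3, proved in the kernel from (irr),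
¬(sur), `p` odd). [cite: LombardoTronto2022, Thm. 3.16 (with Prop. 3.4, Cor. 3.7)]
[cite: MastellaZerman2026, Assumption 2.13 (v)] -/
theorem ClassX9.hasPadicScalarImage [W.IsElliptic] (h : ClassX9 W p) : HasPadicScalarImage W p :=
  hasPadicScalarImage_of_hasIrreducibleModPGaloisRep_of_not_hasSurjectiveModNGaloisRep W p h.ne_two
    h.irr h.not_surj

/-- X9 ⟹ `p ∤ N_E` (good reduction at `p`; MZ26 §2.1 "`N` … coprime with `p`", Howard's
`p ∤ N`). [cite: MastellaZerman2026, Assumption 2.1 / §2.1] -/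
theorem ClassX9.not_dvd_conductorNorm [W.IsElliptic] (h : ClassX9 W p) : ¬ p ∣ W.conductorNorm ℤ :=
  fun hd => (W.dvd_conductorNorm_iff_not_hasGoodReductionAtPrime p).mp hd h.good

/-- **Constructor of the hypothesis structure of Mastella–Zerman 2026 Cor. 4.6 at an X9 pair on a
Heegner frame** (`MastellaZerman2026.Hypotheses (N_E) W K p κ γ`): elliptic, non-CM, (irr), the
scalar image condition (a THEOREM, `ClassX9.hasPadicScalarImage`), `p ≠ 2`, `p ∤ N_E`, good
ordinary — from the leaf; `p ∤ d_K` from `p` split in `K`; left per frame: `K` imaginary quadratic,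
`d_K ≠ -3, -4`, Heegner for `N_E`, `p ∤ h_K`, `(κ, γ)` anticyclotomic with a topological generator.
[cite: MastellaZerman2026, Assumptions 2.1 and 2.13, §4 and §4.1] -/
theorem ClassX9.mz26Hypotheses [hE : W.IsElliptic] (h : ClassX9 W p)
    {K : Type u} [Field K] [NumberField K] (κ : ZpExtension K p) (γ : Field.absoluteGaloisGroup K)
    [NeZero (W.conductorNorm ℤ)]
    (hK : IsImaginaryQuadratic K) (hne : NumberField.discr K ≠ -3 ∧ NumberField.discr K ≠ -4)
    (hHeeg : SatisfiesHeegnerHypothesis (W.conductorNorm ℤ) K) (hHp : SatisfiesHeegnerHypothesis p K)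
    (hh : ¬ p ∣ NumberField.classNumber K) (hac : κ.IsAnticyclotomic) (hγ : κ.IsTopGenerator γ) :
    MastellaZerman2026.Hypotheses (W.conductorNorm ℤ) W K p κ γ where
  isElliptic := hE
  notCM := h.not_hasCM
  irreducible := h.irr
  scalars := h.hasPadicScalarImage
  isImaginaryQuadratic := hK
  discr_ne := hne
  heegner := hHeeg
  p_ne_two := h.ne_two
  not_dvd_level := h.not_dvd_conductorNorm
  not_dvd_discr :=
    Literature.SatisfiesHeegnerHypothesis.not_dvd_discr hK.1 hHp (Fact.out : p.Prime) (dvd_refl p)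
  not_dvd_classNumber := hh
  ordinary := h.isOrdinaryAt
  anticyclotomic := hac
  topGenerator := hγ

/-- **Mastella–Zerman 2026 Cor. 4.6 (Howard's Thm. B without surjectivity) on X9 Heegner frames, BY
NAME** (binder `hMZ : cor46_howardDivisibility_of_scalarImage`): for an X9 pair `(E, p)`, an
imaginary quadratic `K` with `d_K ≠ -3, -4`, Heegner for `N_E`, `p` split, `p ∤ h_K`, and any
anticyclotomic datum, every `Λ`-adic Selmer datum `D`, Heegner family `F` and Selmer-dual datum `X`
satisfy Howard's conclusions: `D.S` torsion-free of rank one, `X.X` of rank one, and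
`char_Λ(X_{Λ-tors}) ∣ I(ℋ_∞)²`. No image certificate is left: the scalar condition is discharged by
`ClassX9.hasPadicScalarImage`. [cite: MastellaZerman2026, Cor. 4.6]
[cite: LombardoTronto2022, Thm. 3.16] -/
theorem ClassX9.mz26_cor46 [W.IsElliptic] (hMZ : cor46_howardDivisibility_of_scalarImage.{u})
    (h : ClassX9 W p)
    {K : Type u} [Field K] [NumberField K] (κ : ZpExtension K p) (γ : Field.absoluteGaloisGroup K)
    (jbar : AlgebraicClosure K →+* ℂ) [NeZero (W.conductorNorm ℤ)]
    (hK : IsImaginaryQuadratic K) (hne : NumberField.discr K ≠ -3 ∧ NumberField.discr K ≠ -4)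
    (hHeeg : SatisfiesHeegnerHypothesis (W.conductorNorm ℤ) K) (hHp : SatisfiesHeegnerHypothesis p K)
    (hh : ¬ p ∣ NumberField.classNumber K) (hac : κ.IsAnticyclotomic) (hγ : κ.IsTopGenerator γ)
    (D : (W.baseChange K).LambdaAdicSelmerData κ γ) (F : HeegnerFamily (W.conductorNorm ℤ) W K κ jbar)
    (X : (W.baseChange K).SelmerDualData κ γ) :
    (Module.Finite (IwasawaAlgebra p) D.S ∧ NoZeroSMulDivisors (IwasawaAlgebra p) D.S ∧
        Module.finrank (IwasawaAlgebra p) D.S = 1) ∧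
      (Module.Finite (IwasawaAlgebra p) X.X ∧ Module.finrank (IwasawaAlgebra p) X.X = 1 ∧
        Module.charIdeal (IwasawaAlgebra p) (Submodule.torsion (IwasawaAlgebra p) X.X) ∣
          heegnerCharIdeal D F ^ 2) :=
  hMZ (W.conductorNorm ℤ) W K p κ γ jbar (h.mz26Hypotheses κ γ hK hne hHeeg hHp hh hac hγ) D F X

end X9

/-! ## 2. Class X10b (`p = 3`, `¬ Surj W 3`) -/

section X10

variable {W : WeierstrassCurve ℚ} [W.IsGloballyMinimal] {p : ℕ} [Fact p.Prime]

/-- **MZ26 Assumption 2.13 (v) holds on class X10b**: for `(E, 3)` with `E[3]` irreducible and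
`ρ̄_{E,3}` not surjective, the `3`-adic image contains every scalar `≡ 1 (mod 3)` (Lombardo–Tronto
2022 Prop. 3.12 — indeed all of `ℤ_3ˣ` — proved in the kernel from (irr), ¬(sur)).
[cite: LombardoTronto2022, Prop. 3.12] [cite: MastellaZerman2026, Assumption 2.13 (v)] -/
theorem ClassX10.hasPadicScalarImage_of_not_surj [W.IsElliptic] (h : ClassX10 W p)
    (hns : ¬ Surj W 3) : HasPadicScalarImage W p := by
  have hp3 : p = 3 := h.1
  subst hp3
  exact hasPadicScalarImage_of_hasIrreducibleModPGaloisRep_of_not_hasSurjectiveModNGaloisRep W 3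
    h.ne_two h.irr hns

/-- X10 ⟹ `p ∤ N_E` (good reduction at `p = 3`). [cite: MastellaZerman2026, Assumption 2.1 / §2.1] -/
theorem ClassX10.not_dvd_conductorNorm [W.IsElliptic] (h : ClassX10 W p) :
    ¬ p ∣ W.conductorNorm ℤ := by
  have hp3 : p = 3 := h.1
  subst hp3
  exact fun hd => (W.dvd_conductorNorm_iff_not_hasGoodReductionAtPrime 3).mp hd h.good_three

/-- **Constructor of `MastellaZerman2026.Hypotheses (N_E) W K 3 κ γ` at an X10b pair on a Heegner
frame with `3` split** (MZ26 is printed for EVERY odd `p`, so `p = 3` is in scope as printed):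
(irr), scalars (a THEOREM, `ClassX10.hasPadicScalarImage_of_not_surj`), `3 ≠ 2`, `3 ∤ N_E`, good
ordinary — from the leaf; `3 ∤ d_K` from `3` split; NON-CM is an explicit binder (X10b has CM
members); left per frame: `K` imaginary quadratic, `d_K ≠ -3, -4`, Heegner for `N_E`, `3 ∤ h_K`,
`(κ, γ)`. [cite: MastellaZerman2026, Assumptions 2.1 and 2.13, §4 and §4.1] -/
theorem ClassX10.mz26Hypotheses_of_not_surj [hE : W.IsElliptic] (h : ClassX10 W p)
    (hns : ¬ Surj W 3) (hCM : ¬ W.HasCM)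
    {K : Type u} [Field K] [NumberField K] (κ : ZpExtension K p) (γ : Field.absoluteGaloisGroup K)
    [NeZero (W.conductorNorm ℤ)]
    (hK : IsImaginaryQuadratic K) (hne : NumberField.discr K ≠ -3 ∧ NumberField.discr K ≠ -4)
    (hHeeg : SatisfiesHeegnerHypothesis (W.conductorNorm ℤ) K) (hHp : SatisfiesHeegnerHypothesis p K)
    (hh : ¬ p ∣ NumberField.classNumber K) (hac : κ.IsAnticyclotomic) (hγ : κ.IsTopGenerator γ) :
    MastellaZerman2026.Hypotheses (W.conductorNorm ℤ) W K p κ γ where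
  isElliptic := hE
  notCM := hCM
  irreducible := h.irr
  scalars := h.hasPadicScalarImage_of_not_surj hns
  isImaginaryQuadratic := hK
  discr_ne := hne
  heegner := hHeeg
  p_ne_two := h.ne_two
  not_dvd_level := h.not_dvd_conductorNorm
  not_dvd_discr :=
    Literature.SatisfiesHeegnerHypothesis.not_dvd_discr hK.1 hHp (Fact.out : p.Prime) (dvd_refl p)
  not_dvd_classNumber := hh
  ordinary := h.isOrdinaryAt
  anticyclotomic := hac
  topGenerator := hγ

/-- **Mastella–Zerman 2026 Cor. 4.6 on X10b Heegner frames with `3` split, BY NAME** (binder `hMZ`):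
Howard's conclusions for every non-CM X10b pair, `K` imaginary quadratic with `d_K ≠ -3, -4`, Heegner
for `N_E`, `3` split, `3 ∤ h_K`. (At `p = 3` neither `Howard2004_thmB` — big image — nor BCK21
Thm. 3.1 — `p > 3` — is available; this is the leaf's only typed print of Howard's divisibility.)
[cite: MastellaZerman2026, Cor. 4.6] [cite: LombardoTronto2022, Prop. 3.12] -/
theorem ClassX10.mz26_cor46_of_not_surj [W.IsElliptic]
    (hMZ : cor46_howardDivisibility_of_scalarImage.{u}) (h : ClassX10 W p) (hns : ¬ Surj W 3)
    (hCM : ¬ W.HasCM)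
    {K : Type u} [Field K] [NumberField K] (κ : ZpExtension K p) (γ : Field.absoluteGaloisGroup K)
    (jbar : AlgebraicClosure K →+* ℂ) [NeZero (W.conductorNorm ℤ)]
    (hK : IsImaginaryQuadratic K) (hne : NumberField.discr K ≠ -3 ∧ NumberField.discr K ≠ -4)
    (hHeeg : SatisfiesHeegnerHypothesis (W.conductorNorm ℤ) K) (hHp : SatisfiesHeegnerHypothesis p K)
    (hh : ¬ p ∣ NumberField.classNumber K) (hac : κ.IsAnticyclotomic) (hγ : κ.IsTopGenerator γ)
    (D : (W.baseChange K).LambdaAdicSelmerData κ γ) (F : HeegnerFamily (W.conductorNorm ℤ) W K κ jbar)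
    (X : (W.baseChange K).SelmerDualData κ γ) :
    (Module.Finite (IwasawaAlgebra p) D.S ∧ NoZeroSMulDivisors (IwasawaAlgebra p) D.S ∧
        Module.finrank (IwasawaAlgebra p) D.S = 1) ∧
      (Module.Finite (IwasawaAlgebra p) X.X ∧ Module.finrank (IwasawaAlgebra p) X.X = 1 ∧
        Module.charIdeal (IwasawaAlgebra p) (Submodule.torsion (IwasawaAlgebra p) X.X) ∣
          heegnerCharIdeal D F ^ 2) :=
  hMZ (W.conductorNorm ℤ) W K p κ γ jbar
    (h.mz26Hypotheses_of_not_surj hns hCM κ γ hK hne hHeeg hHp hh hac hγ) D F X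

end X10

end Literature.NumberTheory.EllipticCurves.Rank1Residual

end
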